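import Summits.QuantumFields.YangMills.Theorems.FluctuationComparisonRegPrIntLS2BetaBlockOffsetCoordinates
import Summits.QuantumFields.YangMills.Theorems.FluctuationComparisonRegPrIntLS2BetaSqrtGaugeFillingTube
import HarnessLib

/-!
# S2β · D-GUARD ∕ (BG∞) — FILL₃ TOOLS ((F3a) of the S-lane box road): the NUMERICS of the stage-3 filling letter — radius `r := 1∕(7200·D²)`, Jordan's bound
# `Λ = (π−r)∕sin r ≤ π²∕(2r)`, net step `m := ρ∕L + 1` with `L := ⌈7D∕r⌉₊` giving the patch radius `(π∕2)·2(m−1)·ε ≤ r∕2` and the packing count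
# `6(n₁∕m+1)²·(2∕(3π))(3r∕2)³ < 1`, the step constant `24Λε + 6(π−r)∕n₁ ≤ (12π²D∕r + 6π)∕ρ` — and the OFFSET–BOND BRIDGE at `d = 3` (the bond from the site of an
# offset vector; its offsets; «every `u` is in the box of every `t`»)

Cell `ym3-torus` (YM ladder rung R3 = continuum `SU(2)` Yang–Mills on the three-torus at fixed lattice data — a RUNG: NOT d = 4, NOT infinite volume,
NOT a mass gap, NOT Clay).  Width seat «width 8» `ym3-torus-px8` (gen 28, toron∕flux lineage ✓p826411 → px17 (W1) ✓p837971), FREE px helper on crux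
`stmt-QuantumFields-20520`; `--kind proof --supports stmt-QuantumFields-20520 --as helper`, count-neutral, DEFINITION-FREE (0 `def`, 0 `instance`, 0 `notation`,
0 `sorry`, default heartbeats).  Brick 4a of the S-lane road for px19 g25's `h₃` (STATUS 2026-09-01T02:57:13Z plan, 02:58:38Z «agreed»; numerics confirmed by
px17 g23 02:41:42Z ∕ 03:04:12Z: `r_S ∝ 1∕D_S²`, absolute).

WHY.  `h₃` asks `∀ E, ∃ A ρ₀, …`: the output scale `A` and the cone radius `r` may depend on the input Lipschitz scale `E` but on NOTHING ELSE.  With `D := max E 1`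
the shell datum is `(D∕ρ)`-slow; subsampling every `m ∝ ρ·r∕D` steps makes the patch radius `≤ r∕2` with a NET of absolute cardinality `6(n₁∕m+1)² ≲ (D∕r)²`, and
the packing condition of ✓p839220 `exists_coneCentre_of_patched` becomes `D²·r ≲ 1` — whence `r ∝ 1∕D²`; then `Λ ≤ π²∕(2r)` (Jordan `sin r ≥ 2r∕π`) and the box
steps of ✓p840472 (R2-S) `24Λε + 6(π−r)∕n₁` are `≤ (12π²D∕r + 6π)∕ρ`.  All constants existence-grade (`A ≈ 8.5·10⁵·D³`), as the plan §116.3 anticipates.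

WHAT IS PROVED (sorry-free; pure `ℝ`∕`ℕ` in §1; `Site`∕`PBond` bookkeeping in §2).
* §1 `radius_facts` (`0 < r ≤ 1`, `r < π`, `3r∕2 ≤ π`, `r ≤ π∕2`), `coneConst_nonneg` (Jordan's `(π − r)∕sin r ≤ π²∕(2r)` is px5 g24's ✓p840532 `Lambda_le`, IMPORTED — the first dry filing's `dedup.landed` caught my copy), ★`patchRadius_le`
  (`7D∕r ≤ L`, `ερ ≤ D` ⟹ `π∕2·(2(ρ∕L+1−1)·ε) ≤ r∕2`), ★★`packing_lt_one` (`r = 1∕(7200D²)`, `1 ≤ L ≤ 8D∕r`, `ρ ≥ 2`, `3n₁ ≤ 4ρ+3` ⟹ the count `< 1`, via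
  `n₁∕m + 1 ≤ 3L` and `54·L²·r³ ≤ 3456·D²·r = 0.48`), ★`stepConst_le`.
* §2 `uuu_eq_of_tri` (three axes covering all directions: `update³ u (t α) (t β) (t γ) = t`), `offset_natCast_add` (the offsets of the site `s + u` are `u`),
  `tgt_natCast_add` (the bond from `s + u` in direction `κ` ends at `s + u|_{κ↦u κ+1}`), `natCast_add_offset_eq` (the site of the offsets of `x` is `x`, ✓p839889).

HONEST SCOPE.  Elementary real arithmetic and lattice bookkeeping; no gauge field beyond the `PBond` structure; nothing of Bałaban's renormalisation-group analysis is
asserted or proved ([Balaban1985RegularSpaces] Thm 2 p.83 — local small gauges — is the consumer's context only).  `h₃` ∕ `hSec` ∕ (BG∞) ∕ `hBG` are NOT proved HERE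
(the next file `…SqrtGaugeFill3` discharges `h₃`); GAP♯∘ (registry v11 UNTOUCHED), the five registered stubs (0∕5), S2β, 20520, 19936, 19200, `YM3TorusSU2` are NOT
proved; no registered stub is closed; rung R3 — NOT d = 4, NOT infinite volume, NOT a mass gap, NOT Clay; the Yang–Mills mass gap is NOT proved.  Axioms standard.

References: T. Bałaban, CMP **99** (1985) 75–102 [Balaban1985RegularSpaces] (Thm 2 p.83).
-/

set_option autoImplicit false

noncomputable section

namespace Summit.QuantumFields.YangMills.Theorems.FluctuationComparisonRegPrIntLS2BetaSqrtGaugeFill3Tools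

open scoped Real
open Literature.MathematicalPhysics.QuantumFieldTheory.Balaban1983to89
open Summit.QuantumFields.YangMills.Theorems.FluctuationComparisonRegPrIntLS2BetaBlockOffsetCoordinates (eq_natCast_add_offset)
open Summit.QuantumFields.YangMills.Theorems.FluctuationComparisonRegPrIntLS2BetaSqrtGaugeFillingTube (Lambda_le)

/-! ## §1 Numerics of the stage-3 filling (radius `r = 1∕(7200·D²)`, net step `m = ρ∕L + 1`, `L = ⌈7D∕r⌉₊`) -/

/-- The radius facts: `0 < r ≤ 1`, `r < π`, `3r∕2 ≤ π`, `r ≤ π∕2`. [folklore] -/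
theorem radius_facts {D r : ℝ} (hD : 1 ≤ D) (hr : r = 1 / (7200 * D ^ 2)) :
    0 < r ∧ r ≤ 1 ∧ r < π ∧ 3 * r / 2 ≤ π ∧ r ≤ π / 2 := by
  have hπ := Real.pi_gt_three
  have hD2 : 1 ≤ D ^ 2 := by nlinarith
  have hr0 : 0 < r := by rw [hr]; positivity
  have hr1 : r ≤ 1 := by
    rw [hr, div_le_one (by positivity)]; nlinarith
  have hr1' : r ≤ 1 / 7200 := by
    rw [hr]; exact one_div_le_one_div_of_le (by norm_num) (by nlinarith)
  exact ⟨hr0, hr1, by linarith, by linarith, by linarith⟩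

/-- `0 ≤ Λ`. [folklore] -/
theorem coneConst_nonneg {r : ℝ} (hr0 : 0 < r) (hrπ : r < π) : 0 ≤ (π - r) / Real.sin r :=
  div_nonneg (by linarith) (Real.sin_nonneg_of_nonneg_of_le_pi hr0.le hrπ.le)

/-- **The patch radius**: with `L ≥ 7D∕r`, `m := ρ∕L + 1` and `ε ≤ D∕ρ`, `(π∕2)·2(m−1)·ε ≤ r∕2`. [folklore] -/
theorem patchRadius_le {D r ε : ℝ} {L ρ : ℕ} (hD : 1 ≤ D) (hr0 : 0 < r) (hL : 7 * D / r ≤ (L : ℝ)) (hρ : 0 < ρ) (hε0 : 0 ≤ ε)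
    (hεD : ε * ρ ≤ D) :
    π / 2 * (((2 * (ρ / L + 1 - 1) : ℕ) : ℝ) * ε) ≤ r / 2 := by
  have hπ := Real.pi_lt_d2
  have hπ0 := Real.pi_pos
  have hL0 : (0 : ℝ) < L := lt_of_lt_of_le (by positivity) hL
  have hρr : (0 : ℝ) < ρ := by exact_mod_cast hρ
  rw [Nat.add_sub_cancel]
  have hq : (((ρ / L : ℕ) : ℕ) : ℝ) ≤ (ρ : ℝ) / L := Nat.cast_div_le
  have h1 : (((2 * (ρ / L) : ℕ)) : ℝ) * ε ≤ 2 * ((ρ : ℝ) / L) * ε := by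
    push_cast
    exact mul_le_mul_of_nonneg_right (by linarith) hε0
  -- `(ρ∕L)·ε ≤ D∕L ≤ r∕7`
  have h2 : (ρ : ℝ) / L * ε ≤ r / 7 := by
    rw [div_mul_eq_mul_div, div_le_iff₀ hL0]
    calc (ρ : ℝ) * ε ≤ D := by rw [mul_comm]; exact hεD
      _ = 7 * D / r * (r / 7) := by field_simp
      _ ≤ (L : ℝ) * (r / 7) := mul_le_mul_of_nonneg_right hL (by positivity)
      _ = r / 7 * L := mul_comm _ _
  calc π / 2 * ((((2 * (ρ / L) : ℕ)) : ℝ) * ε) ≤ π / 2 * (2 * ((ρ : ℝ) / L) * ε) :=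
        mul_le_mul_of_nonneg_left h1 (by positivity)
    _ = π * ((ρ : ℝ) / L * ε) := by ring
    _ ≤ π * (r / 7) := mul_le_mul_of_nonneg_left h2 hπ0.le
    _ ≤ r / 2 := by nlinarith

/-- **The packing count**: with `r = 1∕(7200 D²)`, `1 ≤ L ≤ 8D∕r`, `m := ρ∕L + 1`, `ρ ≥ 2`, `3n₁ ≤ 4ρ + 3`:
`6(n₁∕m + 1)²·(2∕(3π))·(3r∕2)³ < 1`. [folklore] -/
theorem packing_lt_one {D r : ℝ} {L ρ n₁ : ℕ} (hD : 1 ≤ D) (hr : r = 1 / (7200 * D ^ 2)) (hL1 : 1 ≤ L) (hL : (L : ℝ) ≤ 8 * D / r)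
    (hρ : 2 ≤ ρ) (hn₁ : 3 * n₁ ≤ 4 * ρ + 3) :
    ((6 * ((n₁ / (ρ / L + 1) + 1) * (n₁ / (ρ / L + 1) + 1)) : ℕ) : ℝ) * (2 / (3 * π) * (3 * r / 2) ^ 3) < 1 := by
  obtain ⟨hr0, hr1, -, -, -⟩ := radius_facts hD hr
  have hπ := Real.pi_gt_three
  have hLr : (0 : ℝ) < L := by exact_mod_cast hL1
  -- `n₁∕m + 1 ≤ 3L`: `n₁ ≤ 2ρ < 2·m·L`
  have hm : ρ < (ρ / L + 1) * L := by
    have := Nat.lt_div_mul_add (a := ρ) (b := L) (by omega)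
    rw [Nat.add_mul, one_mul]; exact this
  have hq : n₁ / (ρ / L + 1) + 1 ≤ 3 * L := by
    have hn2 : n₁ ≤ 2 * ρ := by omega
    have h2 : n₁ ≤ 2 * ((ρ / L + 1) * L) := le_trans hn2 (Nat.mul_le_mul_left 2 hm.le)
    have h3 : n₁ / (ρ / L + 1) ≤ 2 * L := by
      calc n₁ / (ρ / L + 1) ≤ 2 * ((ρ / L + 1) * L) / (ρ / L + 1) := Nat.div_le_div_right h2
        _ = 2 * L := by
          rw [show 2 * ((ρ / L + 1) * L) = 2 * L * (ρ / L + 1) by ring]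
          exact Nat.mul_div_cancel _ (Nat.succ_pos _)
    calc n₁ / (ρ / L + 1) + 1 ≤ 2 * L + 1 := Nat.add_le_add_right h3 1
      _ ≤ 3 * L := by omega
  have hcnt : ((6 * ((n₁ / (ρ / L + 1) + 1) * (n₁ / (ρ / L + 1) + 1)) : ℕ) : ℝ) ≤ 54 * (L : ℝ) ^ 2 := by
    have h' : ((n₁ / (ρ / L + 1) + 1 : ℕ) : ℝ) ≤ 3 * L := by exact_mod_cast hq
    have h0 : (0 : ℝ) ≤ ((n₁ / (ρ / L + 1) + 1 : ℕ) : ℝ) := Nat.cast_nonneg _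
    push_cast at h' h0 ⊢
    nlinarith
  -- the volume factor `(2∕(3π))(3r∕2)³ ≤ r³`
  have hvol : 2 / (3 * π) * (3 * r / 2) ^ 3 ≤ r ^ 3 := by
    rw [show 2 / (3 * π) * (3 * r / 2) ^ 3 = (9 / (4 * π)) * r ^ 3 by field_simp; ring]
    have : 9 / (4 * π) ≤ 1 := by rw [div_le_one (by positivity)]; linarith
    exact mul_le_of_le_one_left (by positivity) this
  have hvol0 : 0 ≤ 2 / (3 * π) * (3 * r / 2) ^ 3 := by positivity
  -- `54 L² r³ ≤ 54·64·D²·r = 3456∕7200 < 1`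
  have hLr2 : (L : ℝ) ^ 2 * r ^ 3 ≤ 64 * D ^ 2 * r := by
    have h1 : (L : ℝ) * r ≤ 8 * D := by
      have := mul_le_mul_of_nonneg_right hL hr0.le
      rwa [div_mul_cancel₀ _ hr0.ne'] at this
    have h0 : 0 ≤ (L : ℝ) * r := by positivity
    have h2 : ((L : ℝ) * r) ^ 2 ≤ (8 * D) ^ 2 := pow_le_pow_left₀ h0 h1 2
    calc (L : ℝ) ^ 2 * r ^ 3 = ((L : ℝ) * r) ^ 2 * r := by ring
      _ ≤ (8 * D) ^ 2 * r := mul_le_mul_of_nonneg_right h2 hr0.le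
      _ = 64 * D ^ 2 * r := by ring
  have hDr : D ^ 2 * r = 1 / 7200 := by rw [hr]; field_simp
  calc ((6 * ((n₁ / (ρ / L + 1) + 1) * (n₁ / (ρ / L + 1) + 1)) : ℕ) : ℝ) * (2 / (3 * π) * (3 * r / 2) ^ 3)
      ≤ 54 * (L : ℝ) ^ 2 * r ^ 3 := by
        calc _ ≤ 54 * (L : ℝ) ^ 2 * (2 / (3 * π) * (3 * r / 2) ^ 3) := mul_le_mul_of_nonneg_right hcnt hvol0
          _ ≤ 54 * (L : ℝ) ^ 2 * r ^ 3 := mul_le_mul_of_nonneg_left hvol (by positivity)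
    _ ≤ 54 * (64 * D ^ 2 * r) := by nlinarith
    _ = 3456 / 7200 := by rw [show 54 * (64 * D ^ 2 * r) = 3456 * (D ^ 2 * r) by ring, hDr]; ring
    _ < 1 := by norm_num

/-- **The step constant**: with `0 < r ≤ π∕2`, `r < π`, `ρ ≤ n₁`, `0 ≤ ε`, `ερ ≤ D`: `24Λε + 6(π−r)∕n₁ ≤ (12π²D∕r + 6π)∕ρ`. [folklore] -/
theorem stepConst_le {D r ε : ℝ} {ρ n₁ : ℕ} (hr0 : 0 < r) (hrπ2 : r ≤ π / 2) (hrπ : r < π) (hρ : 0 < ρ) (hn₁ : ρ ≤ n₁) (hε0 : 0 ≤ ε)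
    (hεD : ε * ρ ≤ D) :
    24 * ((π - r) / Real.sin r) * ε + 6 * (π - r) / n₁ ≤ (12 * π ^ 2 * D / r + 6 * π) / ρ := by
  have hπ0 := Real.pi_pos
  have hρr : (0 : ℝ) < ρ := by exact_mod_cast hρ
  have hn₁r : (ρ : ℝ) ≤ n₁ := by exact_mod_cast hn₁
  have hn₁0 : (0 : ℝ) < n₁ := lt_of_lt_of_le hρr hn₁r
  have hΛ := Lambda_le hr0 hrπ2
  have hΛ0 := coneConst_nonneg hr0 hrπ
  have hεD' : ε ≤ D / ρ := by rw [le_div_iff₀ hρr]; exact hεD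
  have h1 : 24 * ((π - r) / Real.sin r) * ε ≤ 24 * (π ^ 2 / (2 * r)) * (D / ρ) :=
    mul_le_mul (mul_le_mul_of_nonneg_left hΛ (by norm_num)) hεD' hε0 (by positivity)
  have h2 : 6 * (π - r) / n₁ ≤ 6 * π / ρ := by
    rw [div_le_div_iff₀ hn₁0 hρr]; nlinarith
  calc 24 * ((π - r) / Real.sin r) * ε + 6 * (π - r) / n₁ ≤ 24 * (π ^ 2 / (2 * r)) * (D / ρ) + 6 * π / ρ := add_le_add h1 h2
    _ = (12 * π ^ 2 * D / r + 6 * π) / ρ := by field_simp; ring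

/-! ## §2 The offset–bond bridge at `d = 3` -/

variable {P : Params} {j : ℕ}

/-- At three axes covering all directions, every offset vector lies «in the box of» every other: `update³ u (t α) (t β) (t γ) = t`. [folklore] -/
theorem uuu_eq_of_tri {d : ℕ} {α β γ : Fin d} (hαβ : α ≠ β) (hαγ : α ≠ γ) (hβγ : β ≠ γ) (htri : ∀ κ, κ = α ∨ κ = β ∨ κ = γ)
    (u t : Fin d → ℕ) : Function.update (Function.update (Function.update u α (t α)) β (t β)) γ (t γ) = t := by
  funext κ
  rcases htri κ with h | h | h <;> subst h
  · rw [Function.update_of_ne hαγ, Function.update_of_ne hαβ, Function.update_self]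
  · rw [Function.update_of_ne hβγ, Function.update_self]
  · rw [Function.update_self]

/-- The offsets of the site `s + u` are `u` (given `u κ < N`). [folklore] -/
theorem offset_natCast_add (s u : Fin P.d → ℕ) (κ : Fin P.d) (hu : u κ < P.sitesPerDir j) :
    ((((s κ : ℕ) : ZMod (P.sitesPerDir j)) + ((u κ : ℕ) : ZMod (P.sitesPerDir j))) - ((s κ : ℕ) : ZMod (P.sitesPerDir j))).val = u κ := by
  rw [add_sub_cancel_left, ZMod.val_natCast_of_lt hu]

/-- The target of the bond from the site `s + u` in direction `κ` is the site `s + u|_{κ↦u κ+1}`. [folklore] -/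
theorem tgt_natCast_add (s u : Fin P.d → ℕ) (κ : Fin P.d) :
    (⟨fun κ' => ((s κ' : ℕ) : ZMod (P.sitesPerDir j)) + ((u κ' : ℕ) : ZMod (P.sitesPerDir j)), κ⟩ : PBond P j).tgt =
      fun κ' => ((s κ' : ℕ) : ZMod (P.sitesPerDir j)) + ((Function.update u κ (u κ + 1) κ' : ℕ) : ZMod (P.sitesPerDir j)) := by
  funext κ'
  show Function.update (fun κ' => ((s κ' : ℕ) : ZMod (P.sitesPerDir j)) + ((u κ' : ℕ) : ZMod (P.sitesPerDir j))) κ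
      ((((s κ : ℕ) : ZMod (P.sitesPerDir j)) + ((u κ : ℕ) : ZMod (P.sitesPerDir j))) + 1) κ' = _
  by_cases h : κ' = κ
  · subst h; rw [Function.update_self, Function.update_self]; push_cast; ring
  · rw [Function.update_of_ne h, Function.update_of_ne h]

/-- The site of the offset vector of `x` is `x`. [folklore] -/
theorem natCast_add_offset_eq (s : Fin P.d → ℕ) (x : Site P j) :
    (fun κ => ((s κ : ℕ) : ZMod (P.sitesPerDir j)) + (((x κ - ((s κ : ℕ) : ZMod (P.sitesPerDir j))).val : ℕ) : ZMod (P.sitesPerDir j))) = x := by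
  funext κ
  exact (eq_natCast_add_offset s x κ).symm

end Summit.QuantumFields.YangMills.Theorems.FluctuationComparisonRegPrIntLS2BetaSqrtGaugeFill3Tools

end
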